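import Literature.NumberTheory.Automorphic.TwistedQuotientLevelProdRetraction
import Literature.NumberTheory.Automorphic.TwistedQuotientLevelProdScalarDescent
import Literature.Algebra.Module.QuotientBasisCoordinates
import Literature.RepresentationTheory.GeneralLinear.MatrixRepBaseChange
import HarnessLib

/-!
# Descent of annihilators for matrix coefficient systems `Fun(𝒢 ⧸ L', (R/a)^d)` along
# `k₀ → k₁ → O`

Topic `NumberTheory/Automorphic`; namespace `Literature.NumberTheory.Automorphic.TwistedQuotient`.
Definitions with bodies and theorems; no named fact, no instance, no `sorry`.

Three coefficient rings `k₀ → k₁ → O` (a scalar tower), `a ∈ k₀`, and a matrix representation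
`A₀ : L ⧸ L' → GL_d(k₀/a)`.  Over each ring `R ∈ {k₀, k₁, O}` we have the values
`N_R = (R / a)^d` with `L ⧸ L'` acting through the base-changed matrices, the coefficient system
`W_R = Fun(𝒢 ⧸ L', N_R)` (`oneProdTwist`) and its `Γ`-module `W_R^{L/L'}`; the reduction maps
`k₀/a → k₁/a → O/a` induce semilinear comparison maps `e₀₁, e₁O, e₀O` of the values
(`quotPiSemilinear`) and `Hⁿ` of the twisted quotients (`hKerSemimap`, `semimap`).

**`mem_span_of_smul_semimap_eq_zero`.**  Suppose `k₁` is free over `k₀` (basis `b`) and the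
reduction `k₁/a → O/a` has a `k₁`-linear retraction `r₀`.  If `c₀ ∈ H^q(Γ, W_{k₀}^{L/L'})` has
all its annihilators in `(a')` (`x • c₀ = 0 ⇒ x ∈ (a')`), then for `a₁ ∈ k₁`:
`a₁ • Hⁿ(e₀O) c₀ = 0` in `H^q(Γ, W_O^{L/L'})` implies `a₁ ∈ (a') k₁`.  Proof: `Hⁿ(e₀O) =
Hⁿ(e₁O) ∘ Hⁿ(e₀₁)`; `Hⁿ(e₁O)` is injective (retraction, `…LevelProdRetraction`); so
`a₁ • Hⁿ(e₀₁) c₀ = 0`; the coordinate maps of `b` modulo `a` descend this to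
`b.repr a₁ m • c₀ = 0` for all `m` (`…LevelProdScalarDescent`, `Algebra/Module/
QuotientBasisCoordinates`), whence `b.repr a₁ m ∈ (a')` and `a₁ ∈ (a') k₁`.

This is the passage "`𝒪_{E₀} → 𝒪_{E'} → ℤ̄_p`" for the annihilator condition of a
`ℤ̄_p`-point of the Hecke algebra in [Scholze2015, §V.4, proof of Thm. V.4.1].

## References

* P. Scholze, Ann. of Math. 182 (2015), §V.4. [Scholze2015]
* K. S. Brown, *Cohomology of Groups*, GTM 87 (1982), III.1 Example 3. [Brown1982CohomologyGroups]
-/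

noncomputable section

open CategoryTheory Literature.Algebra.Homology Literature.RepresentationTheory.GeneralLinear
open Literature.Algebra.Module

universe u

namespace Literature.NumberTheory.Automorphic

namespace TwistedQuotient

/-! ### Semilinear coordinatewise maps between `(S)^d` and `(S')^d` -/

section QuotPi

variable {k k' S S' : Type u} [CommRing k] [CommRing k'] [CommRing S] [CommRing S']
  [Algebra k S] [Algebra k' S'] (τ : k →+* k') (ψ : S →+* S')
  (hψ : ∀ c : k, ψ (algebraMap k S c) = algebraMap k' S' (τ c)) (d : ℕ)

/-- **`ψ^d : S^d → S'^d` as a `τ`-semilinear map** (`ψ ∘ algebraMap = algebraMap ∘ τ`).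
[folklore] -/
def quotPiSemilinear : (Fin d → S) →ₛₗ[τ] (Fin d → S') where
  toFun w i := ψ (w i)
  map_add' w w' := funext fun i => by simp
  map_smul' c w := funext fun i => by
    rw [Pi.smul_apply, Pi.smul_apply, Algebra.smul_def, map_mul, hψ, ← Algebra.smul_def]

/-- Unfolding lemma. [folklore] -/
@[simp]
theorem quotPiSemilinear_apply (w : Fin d → S) (i : Fin d) :
    quotPiSemilinear τ ψ hψ d w i = ψ (w i) :=
  rfl

/-- `ψ^d` is equivariant for `matrixRep A` and `matrixRep A^{ψ}` (restricted to `k`, `k'`).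
[folklore] -/
theorem quotPiSemilinear_equivariant {Q : Type u} [Group Q] [IsScalarTower k S (Fin d → S)]
    [IsScalarTower k' S' (Fin d → S')]
    (A : Q →* Matrix (Fin d) (Fin d) S) (h : Q) (w : Fin d → S) :
    quotPiSemilinear τ ψ hψ d (resScalars k (matrixRep A) h w) =
      resScalars k' (matrixRep (A.mapMatrixHom ψ)) h (quotPiSemilinear τ ψ hψ d w) := by
  rw [resScalars_apply, resScalars_apply]
  exact pi_map_matrixRep_self A ψ h w

end QuotPi

/-! ### The three-ring setting -/

section Descent

variable {k₀ k₁ O : Type u} [CommRing k₀] [CommRing k₁] [CommRing O] [Algebra k₀ k₁]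
  [Algebra k₁ O] [Algebra k₀ O] [IsScalarTower k₀ k₁ O]
  {Γ 𝒢 : Type u} [Group Γ] [Group 𝒢] (ι : Γ →* 𝒢) {L' L : Subgroup 𝒢} (hle : L' ≤ L)
  [hN : (L'.subgroupOf L).Normal] (a : k₀) {d : ℕ}
  (A₀ : (L ⧸ L'.subgroupOf L) →* Matrix (Fin d) (Fin d) (k₀ ⧸ Ideal.span ({a} : Set k₀)))

/-- The ideal `(a) k₁`. [folklore] -/
abbrev idealOne : Ideal k₁ := Ideal.span ({algebraMap k₀ k₁ a} : Set k₁)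

/-- The ideal `(a) O`. [folklore] -/
abbrev idealBig : Ideal O := Ideal.span ({algebraMap k₀ O a} : Set O)

omit [Algebra k₁ O] [IsScalarTower k₀ k₁ O] in
/-- `(a) ≤ comap ((a) k₁)`. [folklore] -/
theorem span_le_comap_idealOne :
    Ideal.span ({a} : Set k₀) ≤ (idealOne (k₁ := k₁) a).comap (algebraMap k₀ k₁) := by
  rw [Ideal.span_le, Set.singleton_subset_iff]
  exact Ideal.mem_comap.2 (Ideal.subset_span rfl)

omit [Algebra k₀ k₁] [Algebra k₁ O] [IsScalarTower k₀ k₁ O] in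
/-- `(a) ≤ comap ((a) O)`. [folklore] -/
theorem span_le_comap_idealBig :
    Ideal.span ({a} : Set k₀) ≤ (idealBig (O := O) a).comap (algebraMap k₀ O) := by
  rw [Ideal.span_le, Set.singleton_subset_iff]
  exact Ideal.mem_comap.2 (Ideal.subset_span rfl)

/-- `(a) k₁ ≤ comap ((a) O)`. [folklore] -/
theorem idealOne_le_comap_idealBig :
    idealOne (k₁ := k₁) a ≤ (idealBig (O := O) a).comap (algebraMap k₁ O) := by
  rw [Ideal.span_le, Set.singleton_subset_iff]
  refine Ideal.mem_comap.2 ?_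
  rw [← IsScalarTower.algebraMap_apply]
  exact Ideal.subset_span rfl

/-- The reduction `k₀/a → k₁/a`. [folklore] -/
def red₀₁ : (k₀ ⧸ Ideal.span ({a} : Set k₀)) →+* (k₁ ⧸ idealOne (k₁ := k₁) a) :=
  Ideal.quotientMap _ (algebraMap k₀ k₁) (span_le_comap_idealOne a)

/-- The reduction `k₀/a → O/a`. [folklore] -/
def red₀O : (k₀ ⧸ Ideal.span ({a} : Set k₀)) →+* (O ⧸ idealBig (O := O) a) :=
  Ideal.quotientMap _ (algebraMap k₀ O) (span_le_comap_idealBig a)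

/-- The reduction `k₁/a → O/a`. [folklore] -/
def red₁O : (k₁ ⧸ idealOne (k₁ := k₁) a) →+* (O ⧸ idealBig (O := O) a) :=
  Ideal.quotientMap _ (algebraMap k₁ O) (idealOne_le_comap_idealBig a)

omit [Algebra k₁ O] [IsScalarTower k₀ k₁ O] in
/-- `red₀₁` on representatives. [folklore] -/
@[simp]
theorem red₀₁_mk (x : k₀) :
    red₀₁ (k₁ := k₁) a (Ideal.Quotient.mk _ x) = Ideal.Quotient.mk _ (algebraMap k₀ k₁ x) :=
  Ideal.quotientMap_mk

omit [Algebra k₀ k₁] [Algebra k₁ O] [IsScalarTower k₀ k₁ O] in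
/-- `red₀O` on representatives. [folklore] -/
@[simp]
theorem red₀O_mk (x : k₀) :
    red₀O (O := O) a (Ideal.Quotient.mk _ x) = Ideal.Quotient.mk _ (algebraMap k₀ O x) :=
  Ideal.quotientMap_mk

/-- `red₁O` on representatives. [folklore] -/
@[simp]
theorem red₁O_mk (y : k₁) :
    red₁O (O := O) a (Ideal.Quotient.mk (idealOne (k₁ := k₁) a) y) =
      Ideal.Quotient.mk _ (algebraMap k₁ O y) :=
  Ideal.quotientMap_mk

/-- `red₁O ∘ red₀₁ = red₀O`. [folklore] -/
theorem red₁O_red₀₁ (x : k₀ ⧸ Ideal.span ({a} : Set k₀)) :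
    red₁O (O := O) a (red₀₁ (k₁ := k₁) a x) = red₀O a x := by
  obtain ⟨x, rfl⟩ := Ideal.Quotient.mk_surjective x
  rw [red₀₁_mk, red₁O_mk, red₀O_mk, ← IsScalarTower.algebraMap_apply]

/-- The same as ring homomorphisms. [folklore] -/
theorem red₁O_comp_red₀₁ : (red₁O (O := O) a).comp (red₀₁ (k₁ := k₁) a) = red₀O a :=
  RingHom.ext fun x => red₁O_red₀₁ a x

omit [Algebra k₁ O] [IsScalarTower k₀ k₁ O] in
/-- `red₀₁ ∘ algebraMap = algebraMap ∘ algebraMap`. [folklore] -/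
theorem red₀₁_algebraMap (c : k₀) :
    red₀₁ (k₁ := k₁) a (algebraMap k₀ _ c) = algebraMap k₁ _ (algebraMap k₀ k₁ c) := by
  rw [Ideal.Quotient.algebraMap_eq, Ideal.Quotient.algebraMap_eq, red₀₁_mk]

omit [Algebra k₀ k₁] [Algebra k₁ O] [IsScalarTower k₀ k₁ O] in
/-- `red₀O ∘ algebraMap = algebraMap ∘ algebraMap`. [folklore] -/
theorem red₀O_algebraMap (c : k₀) :
    red₀O (O := O) a (algebraMap k₀ _ c) = algebraMap O _ (algebraMap k₀ O c) := by
  rw [Ideal.Quotient.algebraMap_eq, Ideal.Quotient.algebraMap_eq, red₀O_mk]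

/-- `red₁O ∘ algebraMap = algebraMap ∘ algebraMap`. [folklore] -/
theorem red₁O_algebraMap (c : k₁) :
    red₁O (O := O) a (algebraMap k₁ (k₁ ⧸ idealOne (k₁ := k₁) a) c) =
      algebraMap O _ (algebraMap k₁ O c) := by
  rw [Ideal.Quotient.algebraMap_eq, Ideal.Quotient.algebraMap_eq, red₁O_mk]

/-! ### The three coefficient systems and the comparison maps -/

/-- The values over `k₀`: `(k₀/a)^d` with `L ⧸ L'` acting through `A₀`. [folklore] -/
abbrev sigma₀ : Representation k₀ (L ⧸ L'.subgroupOf L) (Fin d → k₀ ⧸ Ideal.span ({a} : Set k₀)) :=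
  resScalars k₀ (matrixRep A₀)

/-- The values over `k₁`. [folklore] -/
abbrev sigma₁ : Representation k₁ (L ⧸ L'.subgroupOf L) (Fin d → k₁ ⧸ idealOne (k₁ := k₁) a) :=
  resScalars k₁ (matrixRep (A₀.mapMatrixHom (red₀₁ a)))

/-- The values over `O`. [folklore] -/
abbrev sigmaO : Representation O (L ⧸ L'.subgroupOf L) (Fin d → O ⧸ idealBig (O := O) a) :=
  resScalars O (matrixRep (A₀.mapMatrixHom (red₀O a)))

/-- `e₀₁ : (k₀/a)^d → (k₁/a)^d`. [folklore] -/
abbrev e₀₁ : (Fin d → k₀ ⧸ Ideal.span ({a} : Set k₀)) →ₛₗ[algebraMap k₀ k₁]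
    (Fin d → k₁ ⧸ idealOne (k₁ := k₁) a) :=
  quotPiSemilinear (algebraMap k₀ k₁) (red₀₁ a) (red₀₁_algebraMap a) d

/-- `e₀O : (k₀/a)^d → (O/a)^d`. [folklore] -/
abbrev e₀O : (Fin d → k₀ ⧸ Ideal.span ({a} : Set k₀)) →ₛₗ[algebraMap k₀ O]
    (Fin d → O ⧸ idealBig (O := O) a) :=
  quotPiSemilinear (algebraMap k₀ O) (red₀O a) (red₀O_algebraMap a) d

/-- `e₁O : (k₁/a)^d → (O/a)^d`. [folklore] -/
abbrev e₁O : (Fin d → k₁ ⧸ idealOne (k₁ := k₁) a) →ₛₗ[algebraMap k₁ O]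
    (Fin d → O ⧸ idealBig (O := O) a) :=
  quotPiSemilinear (algebraMap k₁ O) (red₁O a) (red₁O_algebraMap a) d

omit [Algebra k₁ O] [IsScalarTower k₀ k₁ O] in
/-- `e₀₁` is equivariant. [folklore] -/
theorem he₀₁ : ∀ (h : L ⧸ L'.subgroupOf L) (w : Fin d → k₀ ⧸ Ideal.span ({a} : Set k₀)),
    e₀₁ (k₁ := k₁) a (sigma₀ a A₀ h w) = sigma₁ a A₀ h (e₀₁ a w) :=
  fun h w => quotPiSemilinear_equivariant _ _ (red₀₁_algebraMap a) d A₀ h w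

omit [Algebra k₀ k₁] [Algebra k₁ O] [IsScalarTower k₀ k₁ O] in
/-- `e₀O` is equivariant. [folklore] -/
theorem he₀O : ∀ (h : L ⧸ L'.subgroupOf L) (w : Fin d → k₀ ⧸ Ideal.span ({a} : Set k₀)),
    e₀O (O := O) a (sigma₀ a A₀ h w) = sigmaO a A₀ h (e₀O a w) :=
  fun h w => quotPiSemilinear_equivariant _ _ (red₀O_algebraMap a) d A₀ h w

/-- `e₁O` is equivariant. [folklore] -/
theorem he₁O : ∀ (h : L ⧸ L'.subgroupOf L) (w : Fin d → k₁ ⧸ idealOne (k₁ := k₁) a),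
    e₁O (O := O) a (sigma₁ a A₀ h w) = sigmaO a A₀ h (e₁O a w) := by
  intro h w
  have h1 := quotPiSemilinear_equivariant (algebraMap k₁ O) (red₁O (O := O) a)
    (red₁O_algebraMap a) d (A₀.mapMatrixHom (red₀₁ a)) h w
  rwa [MonoidHom.mapMatrixHom_mapMatrixHom, red₁O_comp_red₀₁] at h1

/-- `e₀O = e₁O ∘ e₀₁`. [folklore] -/
theorem e₁O_e₀₁ (w : Fin d → k₀ ⧸ Ideal.span ({a} : Set k₀)) :
    e₁O (O := O) a (e₀₁ (k₁ := k₁) a w) = e₀O a w :=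
  funext fun i => red₁O_red₀₁ a (w i)

/-! ### `Hⁿ` of the comparison maps -/

/-- `Hⁿ(e₀O) : H^q(Γ, W_{k₀}^{L/L'}) → H^q(Γ, W_O^{L/L'})`. [folklore] -/
abbrev semimap₀O (q : ℕ) :=
  semimap (hKerSemimap ι hle (sigma₀ a A₀) (sigmaO (O := O) a A₀) (e₀O a) (he₀O a A₀))
    (hKerSemimap_equivariant ι hle _ _ _ (he₀O a A₀)) q

/-- `Hⁿ(e₀₁)`. [folklore] -/
abbrev semimap₀₁ (q : ℕ) :=
  semimap (hKerSemimap ι hle (sigma₀ a A₀) (sigma₁ (k₁ := k₁) a A₀) (e₀₁ a) (he₀₁ a A₀))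
    (hKerSemimap_equivariant ι hle _ _ _ (he₀₁ a A₀)) q

/-- `Hⁿ(e₁O)`. [folklore] -/
abbrev semimap₁O (q : ℕ) :=
  semimap (hKerSemimap ι hle (sigma₁ (k₁ := k₁) a A₀) (sigmaO (O := O) a A₀) (e₁O a) (he₁O a A₀))
    (hKerSemimap_equivariant ι hle _ _ _ (he₁O a A₀)) q

/-- **`Hⁿ(e₀O) = Hⁿ(e₁O) ∘ Hⁿ(e₀₁)`.** [folklore] -/
theorem semimap₁O_semimap₀₁ (q : ℕ)
    (x : groupCohomology (hKerRep (oneProdTwist ι hle (sigma₀ a A₀)) 0) q) :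
    semimap₁O (k₁ := k₁) (O := O) ι hle a A₀ q (semimap₀₁ (k₁ := k₁) ι hle a A₀ q x) = semimap₀O (O := O) ι hle a A₀ q x :=
  semimap_semimap _ _ _ _ _ _ (fun f => Subtype.ext (funext fun y => funext fun c => by
    rw [val_hKerSemimap, val_hKerSemimap, val_hKerSemimap]
    exact (e₁O_e₀₁ a (f.1 y c)).symm)) q x

/-! ### The retraction and the coordinate maps -/

variable (r₀ : (O ⧸ idealBig (O := O) a) →ₗ[k₁] (k₁ ⧸ idealOne (k₁ := k₁) a))
  (hr₀ : ∀ y : k₁, r₀ (Ideal.Quotient.mk _ (algebraMap k₁ O y)) = Ideal.Quotient.mk _ y)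

/-- The coordinatewise retraction `r₀^d : (O/a)^d → (k₁/a)^d`. [folklore] -/
def piRetraction : (Fin d → O ⧸ idealBig (O := O) a) →ₗ[k₁] (Fin d → k₁ ⧸ idealOne (k₁ := k₁) a) :=
  LinearMap.pi fun i => r₀ ∘ₗ LinearMap.proj i

omit [IsScalarTower k₀ k₁ O] in
/-- Unfolding lemma. [folklore] -/
@[simp]
theorem piRetraction_apply (w : Fin d → O ⧸ idealBig (O := O) a) (i : Fin d) :
    piRetraction a r₀ w i = r₀ (w i) :=
  rfl

/-- `r₀ (red₀O(s) x) = red₀₁(s) r₀(x)`: `r₀` is linear for the `k₀/a`-structures. [folklore] -/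
theorem retraction_mul (s : k₀ ⧸ Ideal.span ({a} : Set k₀)) (x : O ⧸ idealBig (O := O) a) :
    r₀ (red₀O a s * x) = red₀₁ a s * r₀ x := by
  obtain ⟨s, rfl⟩ := Ideal.Quotient.mk_surjective s
  have h1 : red₀O (O := O) a (Ideal.Quotient.mk _ s) * x = algebraMap k₀ k₁ s • x := by
    rw [red₀O_mk, Algebra.smul_def, IsScalarTower.algebraMap_apply k₁ O (O ⧸ idealBig (O := O) a),
      Ideal.Quotient.algebraMap_eq, ← IsScalarTower.algebraMap_apply]
  have h2 : red₀₁ (k₁ := k₁) a (Ideal.Quotient.mk _ s) * r₀ x = algebraMap k₀ k₁ s • r₀ x := by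
    rw [red₀₁_mk, Algebra.smul_def, Ideal.Quotient.algebraMap_eq]
  rw [h1, h2, map_smul]

/-- `r₀^d` is equivariant. [folklore] -/
theorem piRetraction_equivariant (h : L ⧸ L'.subgroupOf L) (w : Fin d → O ⧸ idealBig (O := O) a) :
    piRetraction a r₀ (sigmaO a A₀ h w) = sigma₁ (k₁ := k₁) a A₀ h (piRetraction a r₀ w) := by
  rw [resScalars_apply, resScalars_apply]
  funext i
  exact congrFun (pi_map_matrixRep A₀ (red₀O (O := O) a) (red₀₁ (k₁ := k₁) a)
    r₀.toAddMonoidHom (fun s x => retraction_mul a r₀ s x) h w) i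

include hr₀ in
/-- `r₀^d ∘ e₁O = id`. [folklore] -/
theorem piRetraction_e₁O (v : Fin d → k₁ ⧸ idealOne (k₁ := k₁) a) :
    piRetraction a r₀ (e₁O (O := O) a v) = v := by
  funext i
  obtain ⟨y, hy⟩ := Ideal.Quotient.mk_surjective (v i)
  rw [piRetraction_apply, quotPiSemilinear_apply, ← hy, red₁O_mk, hr₀]

variable {M : Type*} (b : Module.Basis M k₀ k₁)

omit [Algebra k₁ O] [IsScalarTower k₀ k₁ O] in
/-- The coordinate maps `quotCoord^d : (k₁/a)^d → (k₀/a)^d`. [folklore] -/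
def piCoord (m : M) : (Fin d → k₁ ⧸ idealOne (k₁ := k₁) a) →ₗ[k₀] (Fin d → k₀ ⧸ Ideal.span ({a} : Set k₀)) :=
  LinearMap.pi fun i => quotCoord b a m ∘ₗ LinearMap.proj i

omit [Algebra k₁ O] [IsScalarTower k₀ k₁ O] in
/-- Unfolding lemma. [folklore] -/
@[simp]
theorem piCoord_apply (m : M) (w : Fin d → k₁ ⧸ idealOne (k₁ := k₁) a) (i : Fin d) :
    piCoord a b m w i = quotCoord b a m (w i) :=
  rfl

omit [Algebra k₁ O] [IsScalarTower k₀ k₁ O] in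
/-- `quotCoord (red₀₁(s) x) = s * quotCoord x`. [folklore] -/
theorem quotCoord_mul (m : M) (s : k₀ ⧸ Ideal.span ({a} : Set k₀)) (x : k₁ ⧸ idealOne (k₁ := k₁) a) :
    quotCoord b a m (red₀₁ a s * x) = (RingHom.id _ s) * quotCoord b a m x := by
  obtain ⟨s, rfl⟩ := Ideal.Quotient.mk_surjective s
  have h1 : red₀₁ (k₁ := k₁) a (Ideal.Quotient.mk _ s) * x = s • x := by
    rw [red₀₁_mk, Algebra.smul_def, IsScalarTower.algebraMap_apply k₀ k₁ (k₁ ⧸ idealOne (k₁ := k₁) a),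
      Ideal.Quotient.algebraMap_eq]
  rw [h1, map_smul, RingHom.id_apply, Algebra.smul_def, Ideal.Quotient.algebraMap_eq]

omit [Algebra k₁ O] [IsScalarTower k₀ k₁ O] in
/-- `quotCoord^d` is equivariant. [folklore] -/
theorem piCoord_equivariant (m : M) (h : L ⧸ L'.subgroupOf L) (w : Fin d → k₁ ⧸ idealOne (k₁ := k₁) a) :
    piCoord a b m (sigma₁ a A₀ h w) = sigma₀ a A₀ h (piCoord a b m w) := by
  rw [resScalars_apply, resScalars_apply]
  funext i
  have h1 := congrFun (pi_map_matrixRep A₀ (red₀₁ (k₁ := k₁) a) (RingHom.id _)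
    (quotCoord b a m).toAddMonoidHom (fun s x => quotCoord_mul a b m s x) h w) i
  rw [MonoidHom.mapMatrixHom_id] at h1
  exact h1

omit [Algebra k₁ O] [IsScalarTower k₀ k₁ O] in
/-- `quotCoord^d (a₁ • e₀₁ v) = (b.repr a₁ m) • v`. [folklore] -/
theorem piCoord_smul_e₀₁ (m : M) (a₁ : k₁) (v : Fin d → k₀ ⧸ Ideal.span ({a} : Set k₀)) :
    piCoord a b m (a₁ • e₀₁ a v) = b.repr a₁ m • v := by
  funext i
  obtain ⟨y, hy⟩ := Ideal.Quotient.mk_surjective (v i)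
  rw [piCoord_apply, Pi.smul_apply, quotPiSemilinear_apply, Pi.smul_apply, ← hy, red₀₁_mk,
    quotCoord_smul_mk_algebraMap]

/-! ### The descent theorem -/

include b hr₀ in
/-- **Descent of annihilators along `k₀ → k₁ → O`.**  If the annihilators of
`c₀ ∈ H^q(Γ, W_{k₀}^{L/L'})` lie in `(a')` and `a₁ ∈ k₁` kills `Hⁿ(e₀O) c₀ ∈ H^q(Γ, W_O^{L/L'})`,
then `a₁ ∈ (a') k₁` (`k₁` free over `k₀`, `k₁/a → O/a` split).
[cite: Scholze2015, §V.4 (proof of Thm. V.4.1)] [cite: Brown1982CohomologyGroups, III.1 Example 3] -/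
theorem mem_span_of_smul_semimap_eq_zero (a' : k₀) (q : ℕ)
    (c₀ : groupCohomology (hKerRep (oneProdTwist ι hle (sigma₀ a A₀)) 0) q)
    (hann : ∀ x : k₀, x • c₀ = 0 → x ∈ Ideal.span ({a'} : Set k₀)) (a₁ : k₁)
    (h : algebraMap k₁ O a₁ • semimap₀O (O := O) ι hle a A₀ q c₀ = 0) :
    a₁ ∈ Ideal.span ({algebraMap k₀ k₁ a'} : Set k₁) := by
  -- `a₁ • Hⁿ(e₀₁) c₀ = 0` by injectivity of `Hⁿ(e₁O)`
  have h1 : semimap₁O (k₁ := k₁) (O := O) ι hle a A₀ q (a₁ • semimap₀₁ (k₁ := k₁) ι hle a A₀ q c₀) = 0 := by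
    rw [map_smulₛₗ, semimap₁O_semimap₀₁, h]
  have hinj := semimap_hKerSemimap_injective_of_retraction ι hle (sigma₁ (k₁ := k₁) a A₀)
    (sigmaO (O := O) a A₀) (e₁O a) (he₁O a A₀) (piRetraction a r₀)
    (piRetraction_equivariant a A₀ r₀) (piRetraction_e₁O a r₀ hr₀) q
  have h2 : a₁ • semimap₀₁ (k₁ := k₁) ι hle a A₀ q c₀ = 0 := hinj (by rw [h1, map_zero])
  -- descend the coordinates
  have h3 : ∀ m : M, b.repr a₁ m • c₀ = 0 := fun m =>
    smul_eq_zero_of_smul_semimap_eq_zero ι hle (sigma₀ a A₀) (sigma₁ (k₁ := k₁) a A₀) (e₀₁ a)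
      (he₀₁ a A₀) (piCoord a b) (piCoord_equivariant a A₀ b) a₁ (fun m => b.repr a₁ m)
      (fun m v => piCoord_smul_e₀₁ a b m a₁ v) q c₀ h2 m
  exact mem_span_algebraMap_of_forall_repr_mem b a' a₁ fun m => hann _ (h3 m)

end Descent

end TwistedQuotient

end Literature.NumberTheory.Automorphic
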